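import Summits.QuantumFields.YangMills.Theorems.BalabanUVNodesN12RootTransporterBj
import HarnessLib

/-!
# BalabanUVNodes ∕ N12 — THE ROOT-TRANSPORTER LETTER WITH A LOCAL MEMBER-AVERAGE LETTER: the chains of `N12BjRootChains(Graded)` read the member averages `M^i(U)(c)` only at their own links,
# and every link has a segment end `walkEnd (root b₋) w`, `|w| ≤ m·L^k` (consecutiveness) — so the letter `dist1 (M^i(U)(c)) ≤ δ₁` is needed only for members within walk-distance `m·L^k` of a
# root, not for all of `bondsOf 𝐁_k(Z)_i` (whose level `0` is `bondsOf (Ω₁ᶜ)`, global)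

Cell `pub-ymgap` (HUMAN RULINGS D-0062 ∕ D-0149), WIDTH SEAT `pub-ymgap-dag-n12-w3` g4 (node N12 = [B15]; key K1⁹ `stmt-QuantumFields-27364` (KEY MAP v2), `--kind proof --supports … --as
helper`; count-neutral).  THEOREMS ONLY (0 `def`, 0 `instance`, 0 `sorry`).

WHY (honest flag, cell bus 2026-08-28 ≈17:58Z).  `N12RootTransporterBj.transporter_of_links` ∕ `rootTransporter_Bj(_graded)` display the member-average letter for ALL members of `𝐁_k(Z)`; at
level `0` these are all bonds meeting `Ω₁ᶜ` — far from `Z` the datum `Q_k^{s*}W` there is a bare `k`-bond variable, not near `1`, so the global premise is uninhabitable in the intended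
instantiation (dag-n12-w5's (vii): `W = ext Vk`).  The proofs only ever read the LINKS of the chain; THIS FILE restates both theorems with the LOCAL premise: ★★ `transporter_of_links_local`
(members with a segment end `= walkEnd r w`, `|w| ≤ Rloc`, `Rloc ≥ (#links)·L^N`; the witness is the flattened prefix, by `hcons`), ★★★ `rootTransporter_Bj_graded_local` (members reachable
from `root x`, `x ∈ Ω₁(Z)`, within `m·L^k`).  The record editions and the capstones follow in `…GaugeLetterLocAtRecordLocal` ∕ `…OfPlaqSmallLocal`.

HONEST FRAMING.  Word bookkeeping + the two proofs of `N12RootTransporterBj` with one premise weakened; nothing of Bałaban's asserted; count-neutral; N12 NOT discharged; K1⁹ NOT closed; counts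
unmoved (typed 28∕28 · discharged 5∕27); one finite 𝕋⁴ programme at fixed ε — R4 closes the conditional rung `BalabanLadder.UV` only; the Yang–Mills mass gap (Clay) is NOT proved by any of
this; nothing continuum ∕ ℝ⁴ ∕ OS.
-/

noncomputable section

namespace Summit.QuantumFields.YangMills.BalabanUVNodes.N12RootTransporterBjLocal

open scoped BigOperators
open Literature.MathematicalPhysics.QuantumFieldTheory.Balaban1983to89
open T4Continuum BlockAveraging
open B15DeterminingSets
open B5Eq118OneStroke (iterBlockOf)
open B14.Eq213MaximalDomains (side)
open B14.Eq213DetSet (Bj Bj_zero maxDomT)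
open T4ForestGaugeCorridorBound (dist1_holAt_chain_mul_prod_inv_le dist1_prod_le_sum dist1_segRev_mul_iter_blockAvg_le)
open BlockAveragingTowerStraightTransportLocal (dist1_straight_mul_inv_iter_le_local)
open Summit.QuantumFields.YangMills.BalabanUVNodes.N12FlatHndRecordLetters (hcov_Bj)
open Summit.QuantumFields.YangMills.BalabanUVNodes.N12BlockChains (length_flatten_le_of_forall_le)
open Summit.QuantumFields.YangMills.BalabanUVNodes.N12BjRootChains (exists_rootChain_Bj exists_chain_root_centre exists_chain_centre_centre)
open Summit.QuantumFields.YangMills.BalabanUVNodes.N12BjRootChainsGraded (exists_rootChain_Bj_graded)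

variable {P : Params} {G : Type*} [GaugeGroup G]

open Summit.QuantumFields.YangMills.BalabanUVNodes.N12RootTransporterBj (theta_mono_of_nonneg)

/-! ## §1 The transporter of a chain, local letter -/

section Links

/-- ★★ **THE TRANSPORTER DATUM OF A MEMBER CHAIN, LOCAL LETTER** — `N12RootTransporterBj.transporter_of_links` with the member-average letter `dist1 (M^i(U)(c)) ≤ δ₁` asked ONLY for members
`c` one of whose segment ends `ι_i c∓` is reached from the chain's root `r` by a fine word of length `≤ Rloc`, `Rloc ≥ (#links)·L^N` (the chain's consecutiveness supplies the word: the flattened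
prefix).  [cite: Balaban1985Variational, (3)–(4) p.278, (16)–(18) p.280; Balaban1985Averaging, (19)–(20) p.21; Balaban1988Convergent, (2.13) pp.256–257] -/
theorem transporter_of_links_local (ℰ : LoopAverage G) (U : GaugeField P 0 G) (κ θ : ℕ → ℝ) (hθ0 : 0 ≤ θ 0) (hθ : ∀ i, κ i + P.L * θ i ≤ θ (i + 1))
    {k N : ℕ} (hθN : ∀ i ≤ N, θ i ≤ θ N) (𝔹 : DetSet P)
    (hκ : ∀ i ≤ k, ∀ c ∈ bondsOf (𝔹 i), ∀ i' < i, ∀ c' : PBond P (i' + 1), c'.dir = c.dir →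
      (∃ t < P.L ^ i, embIter (i' + 1) c'.src = (fun z : Site P 0 => z.shift c.dir)^[t] (embIter i c.src)) →
      dist1 (corr ℰ (Averaging.iter (fun i => blockAvg (P := P) (j := i) ℰ) i' U) c') ≤ κ i')
    (r : Site P 0) (links : List ((m : ℕ) × (PBond P m × Bool)))
    (hmem : ∀ l ∈ links, l.1 ≤ k ∧ l.2.1 ∈ bondsOf (𝔹 l.1)) (hmemN : ∀ l ∈ links, l.1 ≤ N)
    (hcons : ∀ (pre post : List ((m : ℕ) × (PBond P m × Bool))) (l : (m : ℕ) × (PBond P m × Bool)), links = pre ++ l :: post →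
      (l.2.2 = true → walkEnd r (pre.map fun l => List.replicate (P.L ^ l.1) (l.2.1.dir, l.2.2)).flatten = embIter l.1 l.2.1.src) ∧
      (l.2.2 = false → walkEnd r (pre.map fun l => List.replicate (P.L ^ l.1) (l.2.1.dir, l.2.2)).flatten = embIter l.1 l.2.1.tgt))
    -- LOCAL member-average letter: only members reachable from `r` by a fine word of length `≤ Rloc` are read
    {δ₁ : ℝ} {Rloc : ℕ} (hR : links.length * P.L ^ N ≤ Rloc)
    (hδ₁ : ∀ i ≤ k, ∀ c ∈ bondsOf (𝔹 i), (∃ w : List (Letter P.d), w.length ≤ Rloc ∧ (walkEnd r w = embIter i c.src ∨ walkEnd r w = embIter i c.tgt)) →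
      dist1 (Averaging.iter (fun i => blockAvg (P := P) (j := i) ℰ) i U c) ≤ δ₁) :
    ∃ g : G, dist1 (holAt U (walk r (links.map fun l => List.replicate (P.L ^ l.1) (l.2.1.dir, l.2.2)).flatten) * g⁻¹) ≤ links.length * θ N ∧
      dist1 g ≤ links.length * δ₁ ∧
      ((links.map fun l => List.replicate (P.L ^ l.1) (l.2.1.dir, l.2.2)).flatten).length ≤ links.length * P.L ^ N := by
  classical
  -- the links as (word, element, budget) triples
  set M : (m : ℕ) × (PBond P m × Bool) → G := fun l => Averaging.iter (fun i => blockAvg (P := P) (j := i) ℰ) l.1 U l.2.1 with hM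
  set τ : (m : ℕ) × (PBond P m × Bool) → List (Letter P.d) × G × ℝ :=
    fun l => (List.replicate (P.L ^ l.1) (l.2.1.dir, l.2.2), (if l.2.2 then M l else (M l)⁻¹), θ l.1) with hτ
  have hfst : (links.map τ).map Prod.fst = links.map fun l => List.replicate (P.L ^ l.1) (l.2.1.dir, l.2.2) := by
    rw [List.map_map]; rfl
  -- the per-link transporter letter
  have hlinks : ∀ (pre post : List (List (Letter P.d) × G × ℝ)) (link : List (Letter P.d) × G × ℝ), links.map τ = pre ++ link :: post →
      dist1 (holAt U (walk (walkEnd r (pre.map Prod.fst).flatten) link.1) * (link.2.1)⁻¹) ≤ link.2.2 := by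
    intro pre post link h
    obtain ⟨pre₀, rest, hsplit, hpre, hrest⟩ := List.map_eq_append_iff.mp h
    obtain ⟨l₀, post₀, hrest', hl, -⟩ := List.map_eq_cons_iff.mp hrest
    subst hl
    rw [hrest'] at hsplit
    obtain ⟨hl₀k, hl₀mem⟩ := hmem l₀ (by rw [hsplit]; simp)
    have hpre' : (pre.map Prod.fst).flatten = (pre₀.map fun l => List.replicate (P.L ^ l.1) (l.2.1.dir, l.2.2)).flatten := by
      rw [← hpre, List.map_map]; rfl
    have hst := hcons pre₀ post₀ l₀ hsplit
    have hκ₀ := hκ l₀.1 hl₀k l₀.2.1 hl₀mem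
    rw [hpre']
    cases h2 : l₀.2.2
    · -- backward: from `ι c₊` along `(−e_dir)^{L^i}` versus `M(c)⁻¹`
      rw [hst.2 h2]
      have hseg : (τ l₀).1 = wordRev (List.replicate (P.L ^ l₀.1) (l₀.2.1.dir, true)) := by
        show List.replicate (P.L ^ l₀.1) (l₀.2.1.dir, l₀.2.2) = _
        unfold wordRev
        rw [List.map_replicate, List.reverse_replicate, h2]
        rfl
      have hg : (τ l₀).2.1 = (M l₀)⁻¹ := by show (if l₀.2.2 then M l₀ else (M l₀)⁻¹) = _; rw [h2]; rfl
      rw [hseg, hg]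
      exact dist1_segRev_mul_iter_blockAvg_le ℰ U κ θ hθ0 hθ l₀.1 l₀.2.1 hκ₀
    · -- forward: from `ι c₋` along `(+e_dir)^{L^i}` versus `M(c)`
      rw [hst.1 h2]
      have hseg : (τ l₀).1 = List.replicate (P.L ^ l₀.1) (l₀.2.1.dir, true) := by
        show List.replicate (P.L ^ l₀.1) (l₀.2.1.dir, l₀.2.2) = _; rw [h2]
      have hg : (τ l₀).2.1 = M l₀ := by show (if l₀.2.2 then M l₀ else (M l₀)⁻¹) = _; rw [h2]; rfl
      rw [hseg, hg]
      exact dist1_straight_mul_inv_iter_le_local ℰ U κ θ hθ0 hθ l₀.1 l₀.2.1 hκ₀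
  have hchain := dist1_holAt_chain_mul_prod_inv_le U (links.map τ) r hlinks
  rw [hfst] at hchain
  refine ⟨((links.map τ).map fun l => l.2.1).prod, hchain.trans ?_, (dist1_prod_le_sum _).trans ?_, ?_⟩
  · -- `Σ θ_{i_l} ≤ (#links)·θ_N`
    have h : ∀ x ∈ (links.map τ).map (fun l => l.2.2), x ≤ θ N := by
      intro x hx
      obtain ⟨l, hl, rfl⟩ := List.mem_map.mp hx
      obtain ⟨l₀, hl₀, rfl⟩ := List.mem_map.mp hl
      exact hθN l₀.1 (hmemN l₀ hl₀)
    have := List.sum_le_card_nsmul _ (θ N) h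
    rw [List.length_map, List.length_map, nsmul_eq_mul] at this
    exact this
  · -- `Σ dist1 g_l ≤ (#links)·δ₁`
    have h : ∀ x ∈ ((links.map τ).map fun l => l.2.1).map dist1, x ≤ δ₁ := by
      intro x hx
      obtain ⟨g, hg, rfl⟩ := List.mem_map.mp hx
      obtain ⟨l, hl, rfl⟩ := List.mem_map.mp hg
      obtain ⟨l₀, hl₀, rfl⟩ := List.mem_map.mp hl
      obtain ⟨s, t, hst⟩ := List.append_of_mem hl₀
      have hcst := hcons s t l₀ hst
      have hlenS : ((s.map fun l => List.replicate (P.L ^ l.1) (l.2.1.dir, l.2.2)).flatten).length ≤ Rloc := by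
        refine le_trans (length_flatten_le_of_forall_le _ s fun l hl => ?_) (le_trans (Nat.mul_le_mul_right _ ?_) hR)
        · rw [List.length_replicate]; exact Nat.pow_le_pow_right P.L_pos (hmemN l (by rw [hst]; simp [hl]))
        · have := congrArg List.length hst; simp only [List.length_append, List.length_cons] at this; omega
      have hd := hδ₁ l₀.1 (hmem l₀ hl₀).1 l₀.2.1 (hmem l₀ hl₀).2 ⟨_, hlenS, by
        cases h2 : l₀.2.2
        · exact Or.inr (hcst.2 h2)
        · exact Or.inl (hcst.1 h2)⟩
      show dist1 (if l₀.2.2 then M l₀ else (M l₀)⁻¹) ≤ δ₁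
      split_ifs
      · exact hd
      · rw [GaugeGroup.dist1_inv]; exact hd
    have := List.sum_le_card_nsmul _ δ₁ h
    rw [List.length_map, List.length_map, List.length_map, nsmul_eq_mul] at this
    exact this
  · -- total length
    refine length_flatten_le_of_forall_le _ links fun l hl => ?_
    rw [List.length_replicate]
    exact Nat.pow_le_pow_right P.L_pos (hmemN l hl)

end Links

/-! ## §2 The graded root-transporter letter at `𝐁_k(Z)`, local letter -/

section Record

variable {M₁ k : ℕ} {Z : Set (Site P 0)}

/-- ★★★ **THE GRADED ROOT-TRANSPORTER LETTER AT `𝐁_k(Z)`, LOCAL MEMBER-AVERAGE LETTER** — `N12RootTransporterBj.rootTransporter_Bj_graded` with `dist1 (M^i(U)(c)) ≤ δ₁` asked only for members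
`c` with `ι_i c₋` or `ι_i c₊` reachable from `root x`, `x ∈ Ω₁(Z)`, by a fine word of length `≤ m·L^k` (`m = 3·d·(L−1)∕2 + 5`) — the members the root chains actually read ([III] (2.13): they lie in
the blocks around the bond, inside the region).  `0 ≤ δ₁` now explicit.
[cite: Balaban1985Variational, (16)–(18) p.280; Balaban1985RegularSpaces, (1.7) p.77, (1.19) p.79; Balaban1985Averaging, (19)–(20) p.21; Balaban1988Convergent, (2.13) pp.256–257] -/
theorem rootTransporter_Bj_graded_local (hk : k ≤ P.m + P.K) (hk1 : 1 ≤ k) (hM2 : 2 ≤ M₁) (hdiv : side P.L M₁ k ∣ P.sitesPerDir 0) (root : Site P 0 → Site P 0)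
    (hcentre : ∀ (z : Site P 0) (J : ℕ), iterBlockOf J z ∈ (Bj M₁ Z k : DetSet P) J →
      ((1 ≤ J ∧ ∃ c ∈ bondsOf ((Bj M₁ Z k : DetSet P) (J - 1)), (iterBlockOf (J - 1) z = c.src ∨ iterBlockOf (J - 1) z = c.tgt)) ∧
          root z = embIter (J - 1) (iterBlockOf (J - 1) z)) ∨
      (¬ (1 ≤ J ∧ ∃ c ∈ bondsOf ((Bj M₁ Z k : DetSet P) (J - 1)), (iterBlockOf (J - 1) z = c.src ∨ iterBlockOf (J - 1) z = c.tgt)) ∧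
          root z = embIter J (iterBlockOf J z)))
    (ℰ : LoopAverage G) (U : GaugeField P 0 G) (κ θ : ℕ → ℝ) (hθ0 : 0 ≤ θ 0) (hθ : ∀ i, κ i + P.L * θ i ≤ θ (i + 1)) (hθmono : ∀ i j, i ≤ j → θ i ≤ θ j)
    (hκ : ∀ i ≤ k, ∀ c ∈ bondsOf ((Bj M₁ Z k : DetSet P) i), ∀ i' < i, ∀ c' : PBond P (i' + 1), c'.dir = c.dir →
      (∃ t < P.L ^ i, embIter (i' + 1) c'.src = (fun z : Site P 0 => z.shift c.dir)^[t] (embIter i c.src)) →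
      dist1 (corr ℰ (Averaging.iter (fun i => blockAvg (P := P) (j := i) ℰ) i' U) c') ≤ κ i')
    -- LOCAL member-average letter: only members reachable from the root of a point of `Ω₁(Z)` within `m·L^k` fine steps are read
    {δ₁ : ℝ} (hδ0 : 0 ≤ δ₁)
    (hδ₁ : ∀ x ∈ maxDomT M₁ Z 1, ∀ i ≤ k, ∀ c ∈ bondsOf ((Bj M₁ Z k : DetSet P) i),
      (∃ w : List (Letter P.d), w.length ≤ (3 * (P.d * ((P.L - 1) / 2)) + 5) * P.L ^ k ∧ (walkEnd (root x) w = embIter i c.src ∨ walkEnd (root x) w = embIter i c.tgt)) →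
      dist1 (Averaging.iter (fun i => blockAvg (P := P) (j := i) ℰ) i U c) ≤ δ₁) :
    ∀ b : PBond P 0, b.src ∈ maxDomT M₁ Z 1 → b.tgt ∈ maxDomT M₁ Z 1 → root b.src ≠ root b.tgt →
      ∀ J : ℕ, iterBlockOf J b.src ∈ (Bj M₁ Z k : DetSet P) J →
      ∃ (Ωw : List (Letter P.d)) (g : G), walkEnd (root b.src) Ωw = root b.tgt ∧ Ωw.length ≤ (3 * (P.d * ((P.L - 1) / 2)) + 5) * P.L ^ min (J + 1) k ∧
        dist1 (holAt U (walk (root b.src) Ωw) * g⁻¹) ≤ ((3 * (P.d * ((P.L - 1) / 2)) + 5 : ℕ) : ℝ) * θ (min (J + 1) k) ∧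
        dist1 g ≤ ((3 * (P.d * ((P.L - 1) / 2)) + 5 : ℕ) : ℝ) * δ₁ := by
  intro b hbs hbt hne J hJ
  have hM : 1 ≤ M₁ := by omega
  obtain ⟨J', -, hJ'⟩ := hcov_Bj hM hk1 hk hdiv (Z := Z) b.tgt
  obtain ⟨links, hlen, hmem, hgrade, hend, hcons⟩ := exists_rootChain_Bj_graded hk hk1 hM2 hdiv root hcentre b hbs hbt hJ hJ'
  have hR : links.length * P.L ^ min (J + 1) k ≤ (3 * (P.d * ((P.L - 1) / 2)) + 5) * P.L ^ k :=
    Nat.mul_le_mul hlen (Nat.pow_le_pow_right P.L_pos (min_le_right _ _))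
  obtain ⟨g, hH, hg, hl⟩ := transporter_of_links_local ℰ U κ θ hθ0 hθ (fun i hi => hθmono i _ hi) (Bj M₁ Z k) hκ (root b.src) links hmem
    (fun l hl => le_min (hgrade l hl).1 (hmem l hl).1) hcons hR (hδ₁ b.src hbs)
  have hθJ0 : 0 ≤ θ (min (J + 1) k) := hθ0.trans (hθmono 0 _ (Nat.zero_le _))
  have hlenR : (links.length : ℝ) ≤ ((3 * (P.d * ((P.L - 1) / 2)) + 5 : ℕ) : ℝ) := by exact_mod_cast hlen
  exact ⟨_, g, hend, hl.trans (Nat.mul_le_mul_right _ hlen), hH.trans (mul_le_mul_of_nonneg_right hlenR hθJ0), hg.trans (mul_le_mul_of_nonneg_right hlenR hδ0)⟩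

end Record

end Summit.QuantumFields.YangMills.BalabanUVNodes.N12RootTransporterBjLocal

end
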